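import Summits.ResolutionOfSingularities.ResolutionOfSingularities.Theorems.WildQuotientsSummitReductionStubPairQuasiSplitBaseChangeLemmas2
import HarnessLib

/-!
# `WildQuotients.SummitReduction` (stmt-ResolutionOfSingularities-16324), line `FramePerfect`:
# the local ring of a base change at ANY point as a localization of `κ' ⊗_κ B`
# (algebra of stub `stub_pair_orbitBlowupCentreLocal`, file 17)

Route `ResolutionOfSingularities/WildQuotients`, crux `SummitReduction`; helper file of stub
`stub_pair_orbitBlowupCentreLocal` (C2: de Jong 1996, 3.4 Claim (ii) over the orbit centre). Clause
(H2) of the stub concerns the local rings of the GEOMETRIC fibres `X₁ ×_Y Spec K` at the closed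
points over the centre. File `…QuasiSplitBaseChangeLemmas2` of stub QS proved, for a point `x'` of a
fibre product `X ×_Y Y'` over `x` and `y'`, that the fibre local ring `B' = 𝒪_{x'}/𝔪_{y'}𝒪_{x'}` is
the localization of `κ' ⊗_κ B` (`B = 𝒪_x/𝔪_y 𝒪_x`, `κ = κ(y)`, `κ' = κ(y')`) at the extended ideal
`𝔪_x(κ' ⊗_κ B)` WHEN that ideal is maximal (the rational case of an ordinary double point). This
file PROVES the general statement needed off the chart origins, in the same abstract setting:

* `exists_isLocalization_fibreRing_comap` — **`B'` is the localization of `κ' ⊗_κ B` at the prime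
  `𝔑 = h⁻¹(𝔪_{B'})`**, `h : κ' ⊗_κ B → B'` the canonical map, with `𝔑 ⊇ 𝔪_x(κ' ⊗_κ B)`, and
  `𝔑` is `κ'`-rational as soon as `κ' → B'/𝔪_{B'}` is onto (a closed point of a geometric fibre).
-/

set_option linter.dupNamespace false

noncomputable section

open IsLocalRing TensorProduct
open Literature.AlgebraicGeometry.Resolution

namespace Summit.ResolutionOfSingularities.ResolutionOfSingularities.Theorems

universe u

section Main

/-- **The fibre local ring of a base change is a localization of `κ' ⊗_κ B` at a prime over
`𝔪_x`.** In the situation of `exists_isLocalization_fibreRing` (file `…QuasiSplitBaseChangeLemmas2`: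
a point `x'` of `X ×_Y Y'` over `x`, `y'`, `y`; `B = 𝒪_x/𝔪_y𝒪_x`, `B' = 𝒪_{x'}/𝔪_{y'}𝒪_{x'}`,
`κ = κ(y)`, `κ' = κ(y')`, the local rings being localizations of the sections of affine charts
and `𝒪_{x'}` a localization of `Γ(X,U) ⊗_{Γ(Y,V)} Γ(Y',V')` compatibly with the stalk maps) but
WITHOUT the rationality hypothesis: `B' = (κ' ⊗_κ B)_𝔑` for the prime `𝔑 = h⁻¹(𝔪_{B'})` of the
canonical map `h : k' ⊗ b ↦ k' b`, `𝔑 ⊇ 𝔪_x(κ' ⊗_κ B)`; and if `κ' → B'/𝔪_{B'}` is onto then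
`κ' → (κ' ⊗_κ B)/𝔑` is onto. [cite: DeJong1996, 3.4 Claim (ii), p. 64] -/
theorem exists_isLocalization_fibreRing_comap
    {A C A' : Type u} [CommRing A] [CommRing C] [CommRing A'] [Algebra A C] [Algebra A A'] {R O R'
    O' : Type u} [CommRing R] [CommRing O] [CommRing R'] [CommRing O'] [IsLocalRing O] [IsLocalRing
    R'] [IsLocalRing O'] (φ : R →+* O) (ρ : R →+* R') (φ' : R' →+* O') (π : O →+* O') [IsLocalHom π]
    (γA : A →+* R) (γC : C →+* O) (γA' : A' →+* R') (σ : C ⊗[A] A' →+* O') {κ κ' B B' : Type u}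
    [CommRing κ] [CommRing κ'] [CommRing B] [CommRing B'] [IsLocalRing B'] [Algebra κ κ'] [Algebra κ
    B] [Algebra κ' B'] [Algebra κ B'] [IsScalarTower κ κ' B'] (mkκ : R →+* κ) (mkκ' : R' →+* κ')
    (mkB : O →+* B) (mkB' : O' →+* B') [IsLocalHom mkB'] (β : B →+* B') (hsq : ∀ r, φ' (ρ r) = π (φ
    r)) (h0a : ∀ a, γC (algebraMap A C a) = φ (γA a)) (h0b : ∀ a, γA' (algebraMap A A' a) = ρ (γA
    a)) (h1 : ∀ c, σ (c ⊗ₜ 1) = π (γC c)) (h2 : ∀ a', σ (1 ⊗ₜ a') = φ' (γA' a')) (hO : ∀ o : O, ∃ c₁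
    c₂ : C, IsUnit (γC c₂) ∧ o * γC c₂ = γC c₁) (hR' : ∀ r : R', ∃ a₁ a₂ : A', IsUnit (γA' a₂) ∧ r *
    γA' a₂ = γA' a₁) (hR'' : maximalIdeal R' ≤ ((maximalIdeal R').comap γA').map γA') (hO'₁ : ∀ o :
    O', ∃ s u, IsUnit (σ u) ∧ o * σ u = σ s) (hO'₂ : ∀ (I : Ideal (C ⊗[A] A')) (s), σ s ∈ I.map σ →
    ∃ u, IsUnit (σ u) ∧ u * s ∈ I) (hmkκ : Function.Surjective mkκ) (hmkκ' : Function.Surjective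
    mkκ') (hkerκ' : ∀ r ∈ maximalIdeal R', mkκ' r = 0) (hmkB : Function.Surjective mkB) (hmkB' :
    Function.Surjective mkB') (hkerB' : ∀ o, mkB' o = 0 → o ∈ (maximalIdeal R').map φ') (hκκ' : ∀ r,
    algebraMap κ κ' (mkκ r) = mkκ' (ρ r)) (hκB : ∀ r, algebraMap κ B (mkκ r) = mkB (φ r)) (hικ' : ∀
    r', algebraMap κ' B' (mkκ' r') = mkB' (φ' r')) (hβ : ∀ o, β (mkB o) = mkB' (π o)) :
    ∃ h : κ' ⊗[κ] B →+* B', (∀ k b, h (k ⊗ₜ b) = algebraMap κ' B' k * β b) ∧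
      ((maximalIdeal O).map mkB).map (tensorInr κ κ' B) ≤ (maximalIdeal B').comap h ∧
      (Function.Surjective ((Ideal.Quotient.mk (maximalIdeal B')).comp (algebraMap κ' B')) →
        Function.Surjective ((Ideal.Quotient.mk ((maximalIdeal B').comap h)).comp
          (algebraMap κ' (κ' ⊗[κ] B)))) ∧
      (letI := h.toAlgebra; IsLocalization.AtPrime B' ((maximalIdeal B').comap h)) := by
  obtain ⟨h, hh⟩ := exists_fibreRing_hom φ ρ φ' π mkκ mkκ' mkB mkB' β hsq hmkκ hκκ' hκB hικ' hβ
  obtain ⟨g, hg⟩ := exists_fibreRing_g φ ρ γA γC γA' (κ' := κ') mkκ mkκ' mkB h0a h0b hκκ' hκB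
  letI := h.toAlgebra
  set P : Ideal (κ' ⊗[κ] B) := (maximalIdeal B').comap h with hPdef
  have hcomm : ∀ s, mkB' (σ s) = h (g s) :=
    fibreRing_comm φ' π γC γA' σ mkκ' mkB mkB' β h1 h2 hικ' hβ g hg h hh
  -- `𝔪_x (κ' ⊗ B) ⊆ P`
  have hPle : ((maximalIdeal O).map mkB).map (tensorInr κ κ' B) ≤ P := by
    rw [hPdef, Ideal.map_le_iff_le_comap, Ideal.map_le_iff_le_comap]
    intro o ho
    rw [Ideal.mem_comap, Ideal.mem_comap, tensorInr_apply, Ideal.mem_comap, hh, map_one, one_mul, hβ]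
    have hπ : (maximalIdeal O).map π ≤ maximalIdeal O' := ((local_hom_TFAE π).out 0 2).mp ‹IsLocalHom π›
    have hmk : (maximalIdeal O').map mkB' ≤ maximalIdeal B' :=
      ((local_hom_TFAE mkB').out 0 2).mp ‹IsLocalHom mkB'›
    exact hmk (Ideal.mem_map_of_mem mkB' (hπ (Ideal.mem_map_of_mem π ho)))
  haveI : P.IsPrime := Ideal.comap_isPrime h _
  have hunit : ∀ s, IsUnit (σ s) → IsUnit (h (g s)) := fun s hs => by
    rw [← hcomm]; exact hs.map mkB'
  refine ⟨h, hh, hPle, fun hsurj z => ?_, ?_⟩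
  · -- rationality
    obtain ⟨t, rfl⟩ := Ideal.Quotient.mk_surjective z
    obtain ⟨c, hc⟩ := hsurj (Ideal.Quotient.mk _ (h t))
    refine ⟨c, ?_⟩
    rw [RingHom.comp_apply, Ideal.Quotient.mk_eq_mk_iff_sub_mem] at hc ⊢
    change algebraMap κ' (κ' ⊗[κ] B) c - t ∈ (maximalIdeal B').comap h
    rw [Ideal.mem_comap, map_sub, Algebra.TensorProduct.algebraMap_apply, Algebra.algebraMap_self,
      RingHom.id_apply, hh, map_one, mul_one]
    exact hc
  refine isLocalization_atPrime_of_generators g ((IsUnit.submonoid O').comap σ) P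
    (fun s hs hsP => ?_) (fun t => ?_) (fun l => ?_) (fun s hs => ?_) (fun t ht => ?_)
  · -- (a) `g(N) ∩ P = ∅`
    rw [Submonoid.mem_comap, IsUnit.mem_submonoid_iff] at hs
    have hm : h (g s) ∈ maximalIdeal B' := hsP
    exact (mem_nonunits_iff.mp ((IsLocalRing.mem_maximalIdeal _).mp hm)) (hunit s hs)
  · -- (b) generators of `κ' ⊗ B`
    obtain ⟨s, u, hu, e⟩ := fibreRing_generators φ' π γC γA' σ mkκ' mkB h1 h2 hO hR' hmkκ' hmkB g hg t
    exact ⟨s, u, by rwa [Submonoid.mem_comap, IsUnit.mem_submonoid_iff], e⟩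
  · -- (c) generators of `B'`
    obtain ⟨o, rfl⟩ := hmkB' l
    obtain ⟨s, u, hu, e⟩ := hO'₁ o
    refine ⟨s, u, by rwa [Submonoid.mem_comap, IsUnit.mem_submonoid_iff], ?_⟩
    change mkB' o * h (g u) = h (g s)
    rw [← hcomm, ← hcomm, ← map_mul, e]
  · -- (d) the kernel
    change h (g s) = 0 at hs
    rw [← hcomm] at hs
    have hmem : σ s ∈ (((maximalIdeal R').comap γA').map
        (Algebra.TensorProduct.includeRight (R := A) (A := C) (B := A')).toRingHom).map σ := by
      rw [Ideal.map_map]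
      have hc : σ.comp (Algebra.TensorProduct.includeRight (R := A) (A := C) (B := A')).toRingHom =
          φ'.comp γA' := RingHom.ext fun a' => h2 a'
      rw [hc, ← Ideal.map_map]
      exact Ideal.map_mono hR'' (hkerB' _ hs)
    obtain ⟨u, hu, hus⟩ := hO'₂ _ s hmem
    refine ⟨u, by rwa [Submonoid.mem_comap, IsUnit.mem_submonoid_iff], ?_⟩
    have hle : (((maximalIdeal R').comap γA').map
        (Algebra.TensorProduct.includeRight (R := A) (A := C) (B := A')).toRingHom).map g ≤ ⊥ := by
      rw [Ideal.map_map, Ideal.map_le_iff_le_comap]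
      intro a' ha'
      rw [Ideal.mem_comap, RingHom.comp_apply, AlgHom.toRingHom_eq_coe, RingHom.coe_coe,
        Algebra.TensorProduct.includeRight_apply, hg, hkerκ' _ (Ideal.mem_comap.mp ha'),
        TensorProduct.zero_tmul]
      exact Ideal.zero_mem _
    exact (Ideal.mem_bot.mp (hle (Ideal.mem_map_of_mem g hus)))
  · -- (e) units
    have ht' : h t ∉ maximalIdeal B' := ht
    by_contra hn
    exact ht' ((IsLocalRing.mem_maximalIdeal _).mpr (mem_nonunits_iff.mpr hn))

end Main

end Summit.ResolutionOfSingularities.ResolutionOfSingularities.Theorems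

end
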